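import Summits.AtomisticToContinuum.FouriersLaw.Theorems.EmbeddedDrudeMourreMourreDissolutionCosineBochner
import Summits.AtomisticToContinuum.FouriersLaw.Theorems.EmbeddedDrudeMourreMourreDissolutionPoissonWindowInversion
import Literature.MathematicalPhysics.KineticTheory.ZeroWavenumberSpace
import HarnessLib

/-!
# Spectral measure with a continuous density on an open window — stub `stub_spectralWindow` of line `swap-odd-threshold-rigidity`
(crux `EmbeddedDrudeMourre.MourreDissolution`, item stmt-AtomisticToContinuum-12594; helper file, `--supports`)

Registered stub F of the checked skeleton of line `swap-odd-threshold-rigidity` (lead c7), in the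
skeleton's stub namespace `Summit.AtomisticToContinuum.FouriersLaw.Theorems.MourreDissolution`.

Statement: for `C : ℝ → ℝ` continuous, even and positive semidefinite, if the Abel–Poisson transforms
`A_ν(ω) = ∫_{t>0} e^{-νt} cos(ωt) C(t) dt` converge locally uniformly on the open window `(-δ, δ)`
(`δ > 0`) as `ν ↓ 0` to `π g` with `g` continuous there, then there is a finite measure `σ` with
`C t = ∫ cos(ωt) dσ(ω)`, `g ≥ 0` on the window, and `σ|_(−δ,δ) = g dω`.

Proof (glue over the two landed stubs of the same namespace):
1. `stub_cosineBochner` gives a finite `σ₀` with cosine transform `C`; as in the proof of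
   `stub_poissonWindowInversion` we pass to the symmetrisation `σ = ½(σ₀ + σ₀(-·))`, which has the same
   cosine transform (`integral_symm`) and represents the Abel–Poisson transforms as Poisson integrals
   `A_ν(ω) = ∫ ν/((x-ω)²+ν²) dσ(x)` (`integral_exp_neg_mul_cos_mul_cosTransform`).
2. For every `δ' < δ` the compact `[-δ', δ'] ⊆ (-δ, δ)` carries uniform convergence
   (`tendstoLocallyUniformlyOn_iff_forall_isCompact`), so `π g ≥ 0` there (limit of non-negative
   Poisson integrals) and `σ|_(−δ',δ') = (π g / π) dω = g dω`
   (`pi_mul_integral_eq_of_tendstoUniformlyOn` + `restrict_Ioo_eq_withDensity_of_forall_integral`).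
3. Exhaust `(-δ, δ) = ⋃ₙ (-uₙ, uₙ)` along a sequence `uₙ ↑ δ` and glue the restrictions
   (`Measure.restrict_iUnion_congr`, `restrict_withDensity`).
-/

noncomputable section

namespace Summit.AtomisticToContinuum.FouriersLaw.Theorems.MourreDissolution

open MeasureTheory Filter Set Function Topology
open scoped InnerProductSpace ENNReal NNReal
open Literature.MathematicalPhysics.KineticTheory
open Literature.MathematicalPhysics.KineticTheory.HeatConduction
open Literature.MathematicalPhysics.KineticTheory.PhononBoltzmann
open Literature.Analysis.InverseSpectral (poissonKernel_nonneg)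

/-- The window step on a compact sub-window: if the Poisson integrals of a finite measure `σ`
converge uniformly on `[-δ', δ']` to `π g` with `g` continuous there, then `g ≥ 0` on `[-δ', δ']`
and `σ|_(−δ',δ') = g dω`. [folklore] -/
theorem restrict_Ioo_eq_withDensity_of_tendstoUniformlyOn_pi_mul (σ : Measure ℝ)
    [IsFiniteMeasure σ] {δ' : ℝ} {g : ℝ → ℝ} (hg : ContinuousOn g (Icc (-δ') δ'))
    (hunif : TendstoUniformlyOn (fun (ν : ℝ) (ω : ℝ) => ∫ x, ν / ((x - ω) ^ 2 + ν ^ 2) ∂σ)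
      (fun ω => Real.pi * g ω) (𝓝[>] 0) (Icc (-δ') δ')) :
    (∀ ω ∈ Icc (-δ') δ', 0 ≤ g ω) ∧
      σ.restrict (Ioo (-δ') δ') =
        (volume.restrict (Ioo (-δ') δ')).withDensity (fun ω => ENNReal.ofReal (g ω)) := by
  have hh : ContinuousOn (fun ω => Real.pi * g ω) (Icc (-δ') δ') := continuousOn_const.mul hg
  -- `π g ≥ 0` on the closed sub-window, as a pointwise limit of Poisson integrals
  have hpos : ∀ ω ∈ Icc (-δ') δ', 0 ≤ g ω := by
    intro ω hω
    have h0 : 0 ≤ Real.pi * g ω := by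
      refine ge_of_tendsto (hunif.tendsto_at hω) ?_
      filter_upwards [self_mem_nhdsWithin] with ν hν
      exact integral_nonneg (fun x => poissonKernel_nonneg (le_of_lt hν) x ω)
    exact (mul_nonneg_iff_of_pos_left Real.pi_pos).1 h0
  have hpos' : ∀ ω ∈ Ioo (-δ') δ', 0 ≤ Real.pi * g ω :=
    fun ω hω => mul_nonneg Real.pi_pos.le (hpos ω (Ioo_subset_Icc_self hω))
  have hres := restrict_Ioo_eq_withDensity_of_forall_integral σ hh hpos'
    (fun φ hφc hφs hφ0 => pi_mul_integral_eq_of_tendstoUniformlyOn σ hh hunif hφc hφs hφ0)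
  refine ⟨hpos, ?_⟩
  rw [hres]
  refine congrArg _ (funext fun ω => ?_)
  rw [mul_div_cancel_left₀ _ Real.pi_ne_zero]

/-- **Stub F of line `swap-odd-threshold-rigidity` (`stub_spectralWindow`): Bochner + Stieltjes/Poisson
inversion on an open window.** For `C` continuous, even and positive semidefinite over real
coefficient vectors, if the Abel–Poisson transforms `∫_{t>0} e^{-νt} cos(ωt) C(t) dt` converge locally
uniformly on `(-δ, δ)` (`δ > 0`) as `ν ↓ 0` to `π g`, `g` continuous on `(-δ, δ)`, then `C` is the
cosine transform of a finite measure `σ` with `g ≥ 0` on `(-δ, δ)` and `σ|_(−δ,δ) = g dω`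
(cosine Bochner theorem, symmetrisation, Poisson-window inversion on every compact sub-window,
exhaustion of the open window by a sequence of sub-windows). [folklore] -/
theorem stub_spectralWindow :
    ∀ C : ℝ → ℝ, Continuous C → (∀ t : ℝ, C (-t) = C t) →
      (∀ (n : ℕ) (c τ : Fin n → ℝ), 0 ≤ ∑ i, ∑ j, c i * c j * C (τ j - τ i)) →
      ∀ δ : ℝ, 0 < δ → ∀ g : ℝ → ℝ, ContinuousOn g (Set.Ioo (-δ) δ) →
        TendstoLocallyUniformlyOn
          (fun (ν : ℝ) (ω : ℝ) => ∫ t in Set.Ioi (0 : ℝ), Real.exp (-(ν * t)) * (Real.cos (ω * t) * C t))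
          (fun ω => Real.pi * g ω) (𝓝[>] (0 : ℝ)) (Set.Ioo (-δ) δ) →
        ∃ σ : Measure ℝ, IsFiniteMeasure σ ∧
          (∀ t : ℝ, C t = ∫ ω, Real.cos (ω * t) ∂σ) ∧
          (∀ ω ∈ Set.Ioo (-δ) δ, 0 ≤ g ω) ∧
          σ.restrict (Set.Ioo (-δ) δ) =
            (volume.restrict (Set.Ioo (-δ) δ)).withDensity (fun ω => ENNReal.ofReal (g ω)) := by
  intro C hC heven hpsd δ hδ g hg hloc
  -- (1) Bochner and symmetrisation
  obtain ⟨σ₀, hσ₀, hC₀⟩ := stub_cosineBochner C hC heven hpsd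
  haveI : IsFiniteMeasure σ₀ := hσ₀
  obtain ⟨σ, hσ⟩ : ∃ σ : Measure ℝ, σ = (2⁻¹ : ℝ≥0) • (σ₀ + σ₀.map (fun x : ℝ => -x)) :=
    ⟨_, rfl⟩
  haveI hfin : IsFiniteMeasure σ := by rw [hσ]; infer_instance
  have hcos1 : ∀ a : ℝ, ‖Real.cos a‖ ≤ 1 := fun a => by
    rw [Real.norm_eq_abs]; exact Real.abs_cos_le_one a
  have hC' : ∀ t : ℝ, C t = ∫ ω, Real.cos (ω * t) ∂σ := by
    intro t
    rw [hσ, integral_symm σ₀ (F := fun ω => Real.cos (ω * t)) (by fun_prop) (fun ω => hcos1 _)]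
    simp only [neg_mul, Real.cos_neg]
    rw [← hC₀ t]; ring
  -- (2) Poisson representation of the Abel–Poisson transforms
  have hG : ∀ ν : ℝ, 0 < ν → ∀ ω : ℝ,
      ∫ t in Ioi (0:ℝ), Real.exp (-(ν * t)) * (Real.cos (ω * t) * C t) =
        ∫ x, ν / ((x - ω) ^ 2 + ν ^ 2) ∂σ := by
    intro ν hν ω
    rw [hσ, ← integral_exp_neg_mul_cos_mul_cosTransform σ₀ hC₀ hν ω]
    exact integral_congr_ae (ae_of_all _ (fun t => (mul_assoc _ _ _).symm))
  -- (3) the window identity on every compact sub-window `[-δ', δ'] ⊆ (-δ, δ)`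
  have hwin : ∀ δ' : ℝ, δ' < δ →
      (∀ ω ∈ Icc (-δ') δ', 0 ≤ g ω) ∧
        σ.restrict (Ioo (-δ') δ') =
          (volume.restrict (Ioo (-δ') δ')).withDensity (fun ω => ENNReal.ofReal (g ω)) := by
    intro δ' hδ'
    have hsub : Icc (-δ') δ' ⊆ Ioo (-δ) δ := Icc_subset_Ioo (neg_lt_neg hδ') hδ'
    have hunifK := (tendstoLocallyUniformlyOn_iff_forall_isCompact isOpen_Ioo).1 hloc _ hsub
      isCompact_Icc
    have hunif' : TendstoUniformlyOn (fun (ν : ℝ) (ω : ℝ) => ∫ x, ν / ((x - ω) ^ 2 + ν ^ 2) ∂σ)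
        (fun ω => Real.pi * g ω) (𝓝[>] 0) (Icc (-δ') δ') := by
      refine hunifK.congr ?_
      filter_upwards [self_mem_nhdsWithin] with ν hν using fun ω _ => hG ν hν ω
    exact restrict_Ioo_eq_withDensity_of_tendstoUniformlyOn_pi_mul σ (hg.mono hsub) hunif'
  -- (4) exhaustion of the open window by sub-windows
  obtain ⟨u, -, hu, hut⟩ := exists_seq_strictMono_tendsto' hδ
  have hU : (⋃ n, Ioo (-(u n)) (u n)) = Ioo (-δ) δ := by
    refine Subset.antisymm (iUnion_subset fun n =>
      Ioo_subset_Ioo (neg_le_neg (hu n).2.le) (hu n).2.le) (fun ω hω => ?_)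
    obtain ⟨n, hn⟩ := (hut.eventually_const_lt (abs_lt.2 hω)).exists
    exact mem_iUnion.2 ⟨n, abs_lt.1 hn⟩
  refine ⟨σ, hfin, hC', fun ω hω => ?_, ?_⟩
  · exact (hwin |ω| (abs_lt.2 hω)).1 ω ⟨neg_abs_le ω, le_abs_self ω⟩
  · rw [← hU, ← restrict_withDensity (MeasurableSet.iUnion fun n => measurableSet_Ioo),
      Measure.restrict_iUnion_congr]
    intro n
    rw [restrict_withDensity measurableSet_Ioo]
    exact (hwin (u n) (hu n).2).2

end Summit.AtomisticToContinuum.FouriersLaw.Theorems.MourreDissolution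

end
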